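import Summits.QuantumAdvantage.AdviceFreeQNC0.CrossCellObstruction
import Summits.QuantumAdvantage.AdviceFreeQNC0.WindowLocalization
import HarnessLib

/-!
# Cell qa-qnc0 (rung F-Q1, route RingFrame, crux α `RingToElim`): the CROSS-FREE WINDOW
# theorem — a window whose two halves do not read each other is beaten

The blind-window theorem (`BlindWindowStrategies.lean`) beats strategies whose interior selectors
do not read their window.  Here the interior selectors MAY read the window: split a window of
`L + H + M` input bits as `x ++ h ++ z`; it is only required that the selectors at the positions
strictly inside the `x`-half (`0 < g < L`) do not read `z`, and those strictly inside the `z`-half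
(`L + H < g < L + H + M`) do not read `x` — they may read their own half, the middle block `h`,
and everything outside; the middle positions `L ≤ g ≤ L + H`, the window ends and all outside
positions are unrestricted (polylog degree).  Every strategy given by LOCAL RULES of range `≤ H`
(selector `y_g` reads only `u_{g−H}, …, u_{g+H−1}`) is of this kind, for every window.

Mechanism (`mixedWinU_crossFree_eq_cell`): condition on the outside blocks AND on `h`.  Then,
with `i = |x|`, `j = |z|`, `ρ = i + j`, `σ = 2i + j` (mod 3), every position whose character is
constant on cells — the two ends (`c + |h| + ρ`, `… + 2ρ`), the middle block
(`c + |h| + g + σ + W_{g−L}(h)`), the outside triple (`P_{ρ + |h|}`) — contributes to a DOUBLY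
EVEN low-degree cell family `Θ_ij`, however its selector reads the window; the `x`-half
contributes `A_ρ(x)` (arbitrary, even), the `z`-half `B_σ(z)`.  The cross-cell obstruction
(`crossCell_obstruction`) applies fibrewise:

* `mixedWinU_crossFree_le` — the mixed game on `L + H + M` bits with cross-free halves is won on
  at most `(1 − η₁)·2^{L+H+M}` contents (`L, M ≥ n₀`, degree `≤ c₁√L, c₁√M`);
* `ringWinU_crossFree_sqrt_le` — **a walk strategy on `p + (L + H + M) + q` bits of degree
  `≤ c₁√min(L, M)` whose `x`-half interior selectors do not read `z` and whose `z`-half interior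
  selectors do not read `x` wins on at most `θ·2ⁿ` inputs, every charge.**

The cell's theorem (prover qn-prover-3, 2026-08-27); not in print.  WHAT THIS IS NOT: strategies
whose selectors read ACROSS every such split (general α) are untouched; `η₁` tiny; no separation.

## References

* S. Srinivasan, *A robust version of Hegedűs's lemma, with applications*, TheoretiCS 2 (2023),
  Lemma 3.1 [Srinivasan2023] (through `crossCell_obstruction`).
-/

noncomputable section

namespace Summit.QuantumAdvantage.AdviceFreeQNC0

open Finset
open Literature.Computability.MetaComplexity Literature.Computability.MetaComplexity.Smolensky

variable {L H M : ℕ}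

/-! ### Small tools -/

/-- Parities add. -/
private theorem decide_odd_add' (a b : ℕ) :
    decide ((a + b) % 2 = 1) = xor (decide (a % 2 = 1)) (decide (b % 2 = 1)) := by
  rcases Nat.mod_two_eq_zero_or_one a with ha | ha <;>
    rcases Nat.mod_two_eq_zero_or_one b with hb | hb <;> simp [Nat.add_mod, ha, hb]

/-- Three pairwise distinct residues mod `3` contain exactly one zero. -/
theorem xor3_decide_mod3' (n0 n1 n2 : ℕ) (h01 : n0 % 3 ≠ n1 % 3) (h02 : n0 % 3 ≠ n2 % 3)
    (h12 : n1 % 3 ≠ n2 % 3) :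
    xor (decide (n0 % 3 ≠ 0)) (xor (decide (n1 % 3 ≠ 0)) (decide (n2 % 3 ≠ 0))) = false := by
  cases h0 : decide (n0 % 3 ≠ 0) <;> cases h1 : decide (n1 % 3 ≠ 0) <;>
    cases h2 : decide (n2 % 3 ≠ 0) <;>
    simp only [decide_eq_true_eq, decide_eq_false_iff_not, not_not] at h0 h1 h2 <;>
    first | rfl | omega

/-- An even triple read along three indices with pairwise distinct residues is even. -/
theorem xor3_perm (P : ℕ → Bool) (hP : xor (P 0) (xor (P 1) (P 2)) = false)
    (n0 n1 n2 : ℕ) (h01 : n0 % 3 ≠ n1 % 3) (h02 : n0 % 3 ≠ n2 % 3) (h12 : n1 % 3 ≠ n2 % 3) :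
    xor (P (n0 % 3)) (xor (P (n1 % 3)) (P (n2 % 3))) = false := by
  have h0 : n0 % 3 = 0 ∨ n0 % 3 = 1 ∨ n0 % 3 = 2 := by omega
  have h1 : n1 % 3 = 0 ∨ n1 % 3 = 1 ∨ n1 % 3 = 2 := by omega
  have h2 : n2 % 3 = 0 ∨ n2 % 3 = 1 ∨ n2 % 3 = 2 := by omega
  rcases h0 with h0 | h0 | h0 <;> rcases h1 with h1 | h1 | h1 <;> rcases h2 with h2 | h2 | h2 <;>
    first
    | omega
    | (rw [h0, h1, h2]; revert hP; cases P 0 <;> cases P 1 <;> cases P 2 <;> decide)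

/-- The parity bit of a filter of a singleton. -/
private theorem decide_card_filter_singleton' {α : Type*} [DecidableEq α] (a : α) (p : α → Prop)
    [DecidablePred p] :
    decide ((({a} : Finset α).filter p).card % 2 = 1) = decide (p a) := by
  rw [Finset.filter_singleton]
  by_cases h : p a <;> simp [h]

/-- **Pointwise-even masks give an even triple of parities**: if for every position `g` the
three mask bits `e₀ g, e₁ g, e₂ g` have an even number of ones (a walk character is non-zero for
exactly two of the three residues), then the parities of `#{g ∈ S : f g ∧ e_r g}` form an even
triple. -/
theorem xor3_parity_of_pointwise {ι : Type*} (S : Finset ι) (f e₀ e₁ e₂ : ι → Bool)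
    (he : ∀ g, xor (e₀ g) (xor (e₁ g) (e₂ g)) = false) :
    xor (decide ((S.filter fun g => (f g && e₀ g) = true).card % 2 = 1))
      (xor (decide ((S.filter fun g => (f g && e₁ g) = true).card % 2 = 1))
        (decide ((S.filter fun g => (f g && e₂ g) = true).card % 2 = 1))) = false := by
  classical
  have hcount : ∀ e : ι → Bool, (S.filter fun g => (f g && e g) = true).card =
      ∑ g ∈ S, (if (f g && e g) = true then 1 else 0) := fun e => by
    rw [Finset.card_filter]
  have hsum : ((S.filter fun g => (f g && e₀ g) = true).card
      + (S.filter fun g => (f g && e₁ g) = true).card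
      + (S.filter fun g => (f g && e₂ g) = true).card) % 2 = 0 := by
    rw [hcount e₀, hcount e₁, hcount e₂, ← Finset.sum_add_distrib, ← Finset.sum_add_distrib]
    have hdvd : 2 ∣ ∑ g ∈ S, ((if (f g && e₀ g) = true then 1 else 0) +
        (if (f g && e₁ g) = true then 1 else 0) + (if (f g && e₂ g) = true then 1 else 0)) := by
      refine Finset.dvd_sum fun g _ => ?_
      have := he g
      revert this
      cases f g <;> cases e₀ g <;> cases e₁ g <;> cases e₂ g <;> decide
    omega
  rw [← decide_odd_add', ← decide_odd_add', ← Nat.add_assoc, hsum]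
  decide

/-- A selector read on `glue3 (left w') h (right w')` keeps its degree (the map is coordinatewise
a variable or a constant). -/
theorem hasDeg_glueBlocks {D : ℕ} (h : Fin H → Bool) {f : (Fin (L + H + M) → Bool) → Bool}
    (hf : HasDeg f D) :
    HasDeg (fun w' : Fin (L + M) → Bool =>
      f (glue3 (fun i : Fin L => w' (Fin.castAdd M i)) h (fun j : Fin M => w' (Fin.natAdd L j)))) D := by
  unfold HasDeg at *
  refine comp_mem_lowDeg_of_coord (fun w' : Fin (L + M) → Bool =>
    glue3 (fun i : Fin L => w' (Fin.castAdd M i)) h (fun j : Fin M => w' (Fin.natAdd L j)))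
    (fun k => ?_) hf
  unfold glue3
  induction k using Fin.addCases with
  | left k =>
    simp only [Fin.append_left]
    induction k using Fin.addCases with
    | left k₀ =>
      simp only [Fin.append_left]
      have : (fun w' : Fin (L + M) → Bool => if w' (Fin.castAdd M k₀) = true then (1 : ZMod 2) else 0)
          = mono (ZMod 2) {Fin.castAdd M k₀} := by
        funext w'; rw [mono_apply]; simp
      rw [this]; exact mono_mem_lowDeg (by simp)
    | right k₁ =>
      simp only [Fin.append_right]
      exact hasDeg_const (h k₁) 1
  | right k =>
    simp only [Fin.append_right]
    have : (fun w' : Fin (L + M) → Bool => if w' (Fin.natAdd L k) = true then (1 : ZMod 2) else 0)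
        = mono (ZMod 2) {Fin.natAdd L k} := by
      funext w'; rw [mono_apply]; simp
    rw [this]; exact mono_mem_lowDeg (by simp)

/-! ### The cross-free fibre is a cross-cell game -/

/-- **The fibre of a cross-free window is a cross-cell game.**  Mixed game on `L + H + M` bits,
window content `x ++ h ++ z` with `h` FIXED, the selectors at `0 < g < L` reading `x` (and `h`)
but not `z` (`sx`), those at `L + H < g < L + H + M` reading `z` (and `h`) but not `x` (`sz`):
with `i = |x|`, `j = |z|`, `ρ = i + j`, `σ = 2i + j` mod `3`, the win bit is
`Θ_ij ⊕ A_ρ(x) ⊕ B_σ(z)`, where `Θ` collects the outside triple (`P_{ρ+|h|}`), the end `0`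
(`c + |h| + ρ`), the middle block `L ≤ g ≤ L + H` (`c + |h| + g + σ + W_{g−L}(h)`) and the end
`L + H + M` (`c + L + H + M + 2|h| + 2ρ`); `A_ρ(x)` = parity of the `x`-half positions with
`c + |h| + g + ρ + W_g(x) ≢ 0`; `B_σ(z)` = parity of the `z`-half positions with
`c + 2|h| + g + σ + W_{g−L−H}(z) ≢ 0`. -/
theorem mixedWinU_crossFree_eq_cell (hL : 0 < L) (hM : 0 < M) (c : ℕ)
    (P : ℕ → (Fin (L + H + M) → Bool) → Bool)
    (y : Fin (L + H + M + 1) → (Fin (L + H + M) → Bool) → Bool) (h : Fin H → Bool)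
    (sx : Fin (L + H + M + 1) → (Fin L → Bool) → Bool) (sz : Fin (L + H + M + 1) → (Fin M → Bool) → Bool)
    (hx : ∀ g : Fin (L + H + M + 1), 0 < g.val → g.val < L →
      ∀ (x : Fin L → Bool) (z : Fin M → Bool), y g (glue3 x h z) = sx g x)
    (hz : ∀ g : Fin (L + H + M + 1), L + H < g.val → g.val < L + H + M →
      ∀ (x : Fin L → Bool) (z : Fin M → Bool), y g (glue3 x h z) = sz g z)
    (x : Fin L → Bool) (z : Fin M → Bool) :
    mixedWinU c P y (glue3 x h z) =
      xor (xor (P (((wt x % 3 + wt z % 3) % 3 + wt h) % 3) (glue3 x h z))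
            (xor (y 0 (glue3 x h z) && decide ((c + wt h + (wt x % 3 + wt z % 3) % 3) % 3 ≠ 0))
              (xor (decide ((((univ : Finset (Fin (L + H + M + 1))).filter fun g =>
                      L ≤ g.val ∧ g.val ≤ L + H).filter fun g =>
                      (y g (glue3 x h z) && decide ((c + wt h + g.val + (2 * (wt x % 3) + wt z % 3) % 3
                        + wtPrefix h (g.val - L)) % 3 ≠ 0)) = true).card % 2 = 1))
                (y (Fin.last (L + H + M)) (glue3 x h z) &&
                  decide ((c + (L + H + M) + 2 * wt h + 2 * ((wt x % 3 + wt z % 3) % 3)) % 3 ≠ 0)))))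
        (xor (decide ((((univ : Finset (Fin (L + H + M + 1))).filter fun g =>
                  0 < g.val ∧ g.val < L).filter fun g =>
                  (sx g x && decide ((c + wt h + g.val + (wt x + wt z) % 3 + wtPrefix x g.val) % 3 ≠ 0))
                    = true).card % 2 = 1))
          (decide ((((univ : Finset (Fin (L + H + M + 1))).filter fun g =>
                  L + H < g.val ∧ g.val < L + H + M).filter fun g =>
                  (sz g z && decide ((c + 2 * wt h + g.val + (2 * wt x + wt z) % 3
                    + wtPrefix z (g.val - (L + H))) % 3 ≠ 0)) = true).card % 2 = 1))) := by
  classical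
  set w := glue3 x h z with hw
  have hwt : wt w = wt x + wt h + wt z := wt_glue3 x h z
  set S := univ.filter fun g : Fin (L + H + M + 1) =>
    y g w = true ∧ (c + g.val + walkExp w g.val) % 3 ≠ 0 with hS
  have hsplit : S.card = (S.filter fun g => g.val = 0).card
      + (S.filter fun g => 0 < g.val ∧ g.val < L).card
      + (S.filter fun g => L ≤ g.val ∧ g.val ≤ L + H).card
      + (S.filter fun g => L + H < g.val ∧ g.val < L + H + M).card
      + (S.filter fun g => g.val = L + H + M).card := by
    have h1 : ∀ g ∈ S, (1 : ℕ) = (if g.val = 0 then 1 else 0) + (if 0 < g.val ∧ g.val < L then 1 else 0)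
        + (if L ≤ g.val ∧ g.val ≤ L + H then 1 else 0)
        + (if L + H < g.val ∧ g.val < L + H + M then 1 else 0)
        + (if g.val = L + H + M then 1 else 0) := by
      intro g _
      have := g.isLt
      split_ifs <;> omega
    rw [Finset.card_eq_sum_ones, Finset.sum_congr rfl h1, Finset.sum_add_distrib,
      Finset.sum_add_distrib, Finset.sum_add_distrib, Finset.sum_add_distrib]
    simp only [Finset.card_filter]
  -- `g = 0`
  have h0 : decide ((S.filter fun g => g.val = 0).card % 2 = 1) =
      (y 0 w && decide ((c + wt h + (wt x % 3 + wt z % 3) % 3) % 3 ≠ 0)) := by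
    have hset : (S.filter fun g => g.val = 0) = ({(0 : Fin (L + H + M + 1))} : Finset _).filter
        fun g => y g w = true ∧ (c + g.val + walkExp w g.val) % 3 ≠ 0 := by
      ext g
      simp only [hS, Finset.mem_filter, Finset.mem_univ, true_and, Finset.mem_singleton]
      constructor
      · rintro ⟨h1, h2⟩; exact ⟨Fin.ext h2, h1⟩
      · rintro ⟨h1, h2⟩; exact ⟨h2, by rw [h1]; rfl⟩
    rw [hset, decide_card_filter_singleton']
    have hzero : wtPrefix w 0 = 0 := by unfold wtPrefix; simp
    have hchar : (c + (0 : Fin (L + H + M + 1)).val + walkExp w (0 : Fin (L + H + M + 1)).val) % 3 =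
        (c + wt h + (wt x % 3 + wt z % 3) % 3) % 3 := by
      simp only [Fin.val_zero, walkExp, hzero, hwt]; omega
    rw [hchar]
    cases y 0 w <;> simp
  -- `0 < g < L`
  have hA : (S.filter fun g => 0 < g.val ∧ g.val < L) =
      ((univ : Finset (Fin (L + H + M + 1))).filter fun g => 0 < g.val ∧ g.val < L).filter fun g =>
        (sx g x && decide ((c + wt h + g.val + (wt x + wt z) % 3 + wtPrefix x g.val) % 3 ≠ 0))
          = true := by
    rw [hS, Finset.filter_filter, Finset.filter_filter]
    refine Finset.filter_congr fun g _ => ?_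
    have hpre : 0 < g.val → g.val < L →
        (c + g.val + walkExp w g.val) % 3 = (c + wt h + g.val + (wt x + wt z) % 3 + wtPrefix x g.val) % 3 := by
      intro h1 h2
      unfold walkExp
      rw [hwt, hw, wtPrefix_glue3_of_le x h z (by omega : g.val ≤ L)]
      omega
    constructor
    · rintro ⟨⟨h1, h2⟩, h3, h4⟩
      refine ⟨⟨h3, h4⟩, ?_⟩
      rw [← hx g h3 h4 x z, ← hw, h1, ← hpre h3 h4]
      simp [h2]
    · rintro ⟨⟨h3, h4⟩, h5⟩
      rw [← hx g h3 h4 x z, ← hw] at h5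
      refine ⟨⟨?_, ?_⟩, h3, h4⟩
      · revert h5; cases y g w <;> simp
      · rw [hpre h3 h4]; revert h5; cases y g w <;> simp
  -- `L ≤ g ≤ L + H`
  have hMid : (S.filter fun g => L ≤ g.val ∧ g.val ≤ L + H) =
      ((univ : Finset (Fin (L + H + M + 1))).filter fun g => L ≤ g.val ∧ g.val ≤ L + H).filter fun g =>
        (y g w && decide ((c + wt h + g.val + (2 * (wt x % 3) + wt z % 3) % 3
          + wtPrefix h (g.val - L)) % 3 ≠ 0)) = true := by
    rw [hS, Finset.filter_filter, Finset.filter_filter]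
    refine Finset.filter_congr fun g _ => ?_
    have hpre : L ≤ g.val → g.val ≤ L + H → (c + g.val + walkExp w g.val) % 3 =
        (c + wt h + g.val + (2 * (wt x % 3) + wt z % 3) % 3 + wtPrefix h (g.val - L)) % 3 := by
      intro h1 h2
      have hWg : wtPrefix w g.val = wt x + wtPrefix h (g.val - L) := by
        obtain ⟨d, hd⟩ : ∃ d, g.val = L + d := ⟨g.val - L, by omega⟩
        rw [hw, hd, wtPrefix_glue3_window x h z (by omega : d ≤ H), Nat.add_sub_cancel_left]
      unfold walkExp
      rw [hwt, hWg]
      omega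
    constructor
    · rintro ⟨⟨h1, h2⟩, h3, h4⟩
      refine ⟨⟨h3, h4⟩, ?_⟩
      rw [h1, ← hpre h3 h4]
      simp [h2]
    · rintro ⟨⟨h3, h4⟩, h5⟩
      refine ⟨⟨?_, ?_⟩, h3, h4⟩
      · revert h5; cases y g w <;> simp
      · rw [hpre h3 h4]; revert h5; cases y g w <;> simp
  -- `L + H < g < L + H + M`
  have hB : (S.filter fun g => L + H < g.val ∧ g.val < L + H + M) =
      ((univ : Finset (Fin (L + H + M + 1))).filter fun g =>
        L + H < g.val ∧ g.val < L + H + M).filter fun g =>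
        (sz g z && decide ((c + 2 * wt h + g.val + (2 * wt x + wt z) % 3
          + wtPrefix z (g.val - (L + H))) % 3 ≠ 0)) = true := by
    rw [hS, Finset.filter_filter, Finset.filter_filter]
    refine Finset.filter_congr fun g _ => ?_
    have hpre : L + H < g.val → g.val < L + H + M → (c + g.val + walkExp w g.val) % 3 =
        (c + 2 * wt h + g.val + (2 * wt x + wt z) % 3 + wtPrefix z (g.val - (L + H))) % 3 := by
      intro h1 h2
      unfold walkExp
      rw [hwt, hw, wtPrefix_glue3_of_ge x h z (by omega : L + H ≤ g.val)]
      omega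
    constructor
    · rintro ⟨⟨h1, h2⟩, h3, h4⟩
      refine ⟨⟨h3, h4⟩, ?_⟩
      rw [← hz g h3 h4 x z, ← hw, h1, ← hpre h3 h4]
      simp [h2]
    · rintro ⟨⟨h3, h4⟩, h5⟩
      rw [← hz g h3 h4 x z, ← hw] at h5
      refine ⟨⟨?_, ?_⟩, h3, h4⟩
      · revert h5; cases y g w <;> simp
      · rw [hpre h3 h4]; revert h5; cases y g w <;> simp
  -- `g = L + H + M`
  have hE : decide ((S.filter fun g => g.val = L + H + M).card % 2 = 1) =
      (y (Fin.last (L + H + M)) w &&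
        decide ((c + (L + H + M) + 2 * wt h + 2 * ((wt x % 3 + wt z % 3) % 3)) % 3 ≠ 0)) := by
    have hset : (S.filter fun g => g.val = L + H + M) = (({Fin.last (L + H + M)} : Finset _).filter
        fun g => y g w = true ∧ (c + g.val + walkExp w g.val) % 3 ≠ 0) := by
      ext g
      simp only [hS, Finset.mem_filter, Finset.mem_univ, true_and, Finset.mem_singleton]
      constructor
      · rintro ⟨h1, h2⟩; exact ⟨Fin.ext (by simp [h2]), h1⟩
      · rintro ⟨h1, h2⟩; exact ⟨h2, by rw [h1]; simp⟩
    rw [hset, decide_card_filter_singleton']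
    have hchar : (c + (Fin.last (L + H + M)).val + walkExp w (Fin.last (L + H + M)).val) % 3 =
        (c + (L + H + M) + 2 * wt h + 2 * ((wt x % 3 + wt z % 3) % 3)) % 3 := by
      simp only [Fin.val_last, walkExp, hwt]
      rw [hw, wtPrefix_of_length_le (glue3 x h z) le_rfl, hwt]
      omega
    rw [hchar]
    cases y (Fin.last (L + H + M)) w <;> simp
  -- assemble
  have hPidx : wt w % 3 = ((wt x % 3 + wt z % 3) % 3 + wt h) % 3 := by rw [hwt]; omega
  unfold mixedWinU ringWinU
  rw [hPidx, hsplit, decide_odd_add', decide_odd_add', decide_odd_add', decide_odd_add', h0, hA,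
    hMid, hB, hE]
  generalize P (((wt x % 3 + wt z % 3) % 3 + wt h) % 3) w = bP
  generalize (y 0 w && decide ((c + wt h + (wt x % 3 + wt z % 3) % 3) % 3 ≠ 0)) = b0
  generalize (y (Fin.last (L + H + M)) w &&
    decide ((c + (L + H + M) + 2 * wt h + 2 * ((wt x % 3 + wt z % 3) % 3)) % 3 ≠ 0)) = bE
  generalize decide ((((univ : Finset (Fin (L + H + M + 1))).filter fun g =>
      L ≤ g.val ∧ g.val ≤ L + H).filter fun g =>
      (y g w && decide ((c + wt h + g.val + (2 * (wt x % 3) + wt z % 3) % 3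
        + wtPrefix h (g.val - L)) % 3 ≠ 0)) = true).card % 2 = 1) = bM
  generalize decide ((((univ : Finset (Fin (L + H + M + 1))).filter fun g =>
      0 < g.val ∧ g.val < L).filter fun g =>
      (sx g x && decide ((c + wt h + g.val + (wt x + wt z) % 3 + wtPrefix x g.val) % 3 ≠ 0))
        = true).card % 2 = 1) = bA
  generalize decide ((((univ : Finset (Fin (L + H + M + 1))).filter fun g =>
      L + H < g.val ∧ g.val < L + H + M).filter fun g =>
      (sz g z && decide ((c + 2 * wt h + g.val + (2 * wt x + wt z) % 3
        + wtPrefix z (g.val - (L + H))) % 3 ≠ 0)) = true).card % 2 = 1) = bB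
  cases bP <;> cases b0 <;> cases bE <;> cases bM <;> cases bA <;> cases bB <;> rfl

end Summit.QuantumAdvantage.AdviceFreeQNC0
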